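import Literature.AlgebraicGeometry.Modules.RestrictOpenCoh
import Literature.AlgebraicGeometry.Modules.PushforwardClosedImmersionCoh
import Literature.AlgebraicGeometry.Modules.QcohLocalization
import Literature.AlgebraicGeometry.Morphisms.FormalFunctionsModuleComplete
import HarnessLib

/-!
# Direct images of coherent modules under proper morphisms are coherent

Grothendieck's finiteness theorem in degree `0` (EGA III Thm. 3.2.1; Görtz–Wedhorn II, Thm. 23.17 /
Cor. 23.18 for `i = 0`; The Stacks Project, Tag 02O5, Cohomology of Schemes, Proposition 30.19.1:
"Let `S` be a locally Noetherian scheme. Let `f : X → S` be a proper morphism. Let `𝓕` be a coherent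
`𝒪_X`-module. Then `R^i f_* 𝓕` is a coherent `𝒪_S`-module for all `i ≥ 0`", case `i = 0`), for
the affine-local coherence predicate `Coh` of `Morphisms/DevissageClass` and Mathlib's direct image
`Scheme.Modules.pushforward π` (sections `Γ(V, π_* G) = Γ(π⁻¹V, G)`, definitional):

* `exists_map_eq_pow_smul_of_noetherianSpace`, `exists_pow_smul_eq_zero_of_noetherianSpace` —
  Hartshorne II Lemma 5.3 on a NON-affine quasi-compact open `U` of a Noetherian scheme: for an
  affine-localizing `G`, `t ∈ Γ(U, 𝒪)`, every section of `G` over `D(t) = X_t ∩ U` becomes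
  extendable to `U` after multiplication by `tⁿ`, and a section over `U` vanishing on `D(t)` is
  killed by a power of `t` (finite affine cover, uniform exponents, gluing);
* `isAffineLocalizing_pushforward` — hence `π_* G` is affine-localizing (= quasi-coherent, EGA I
  1.4.1) for ANY morphism `π : X' → X` from a Noetherian scheme (`π⁻¹D(r) = D(π^* r)`; Hartshorne II
  Prop. 5.8 (c));
* `moduleFinite_app_pushforward_of_isProper`, `isAffineFiniteType_pushforward_of_isProper` — for
  `π` PROPER and `X` locally Noetherian, `Γ(π⁻¹V, G)` is a finite `Γ(V, 𝒪_X)`-module for every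
  affine open `V` (the finiteness theorem `FormalFunctionsModuleComplete.moduleFinite_msections_of_coh`
  = GW II Thm. 23.17, `i = 0`, applied to the proper `V`-scheme `π⁻¹V → V = Spec Γ(V, 𝒪_X)` and
  the coherent restriction `G|_{π⁻¹V}`, `Modules/RestrictOpenCoh`);
* `coh_pushforward_of_isProper` — **`π_* G` is coherent for `π` proper and `G` coherent.**

Everything is proved; no named facts. Mathlib searched (pin v4.32): `Scheme.Modules.pushforward`,
`Scheme.preimage_basicOpen`, `Scheme.basicOpen_res`, `TopCat.Sheaf.existsUnique_gluing'`,
`TopCat.Sheaf.eq_of_locally_eq'`, `morphismRestrict_appTop`, `IsAffineOpen.isoSpec_hom_appTop`,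
`NoetherianSpace.isCompact`, `Scheme.Modules.isSheaf` (used); Mathlib has no finiteness theorem for proper
morphisms.

## References

* A. Grothendieck, EGA III (Publ. Math. IHÉS 11, 1961), Thm. 3.2.1. [EGAIII1]
* U. Görtz, T. Wedhorn, *Algebraic Geometry II* (2023): Thm. 23.17, Cor. 23.18 (pp. 424–425).
  [GortzWedhorn2023]
* The Stacks Project, Tag 02O5 (Cohomology of Schemes, Proposition 30.19.1). [StacksProject]
* R. Hartshorne, *Algebraic Geometry* (1977): II Lemma 5.3 (p. 112), II Prop. 5.8 (c) (p. 115),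
  III Thm. 8.8 (b) (p. 252). [Hartshorne1977]
-/

noncomputable section

-- `TopCat.Presheaf`/`TopCat.Sheaf` are not reducible (as in Mathlib's `AlgebraicGeometry/Modules`).
set_option backward.isDefEq.respectTransparency false

open CategoryTheory AlgebraicGeometry Limits TopologicalSpace Opposite
open Literature.AlgebraicGeometry.Modules

universe u

namespace Literature.AlgebraicGeometry.Morphisms

/-! ### Finite affine covers of quasi-compact opens -/

section Cover

variable {X : Scheme.{u}}

/-- A quasi-compact open of a scheme is covered by finitely many affine opens contained in it.
[folklore] -/
theorem exists_finset_affine_cover (U : X.Opens) (hU : IsCompact (U : Set X)) :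
    ∃ t : Finset {V : X.affineOpens // (V : X.Opens) ≤ U},
      ⨆ V : t, (((V : {V : X.affineOpens // (V : X.Opens) ≤ U}) : X.affineOpens) : X.Opens) = U := by
  classical
  obtain ⟨t, ht⟩ := hU.elim_finite_subcover
    (fun V : {V : X.affineOpens // (V : X.Opens) ≤ U} => ((V : X.affineOpens) : Set X))
    (fun V => (V : X.affineOpens).1.isOpen) fun x hx => by
      obtain ⟨V, hV, hxV, hVU⟩ := Opens.isBasis_iff_nbhd.mp X.isBasis_affineOpens hx
      exact Set.mem_iUnion.mpr ⟨⟨⟨V, hV⟩, hVU⟩, hxV⟩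
  refine ⟨t, le_antisymm (iSup_le fun V => V.1.2) fun x hx => ?_⟩
  obtain ⟨V, hV, hxV⟩ := Set.mem_iUnion₂.mp (ht hx)
  exact Opens.mem_iSup.mpr ⟨⟨V, hV⟩, hxV⟩

end Cover

/-! ### Hartshorne II Lemma 5.3 over a quasi-compact open of a Noetherian scheme -/

section Qcqs

variable {X : Scheme.{u}} [NoetherianSpace X] {G : X.Modules}

/-- **Torsion over a quasi-compact open** (Hartshorne II Lemma 5.3 (a) for `U` quasi-compact): a
section `x ∈ Γ(U, G)` vanishing on (an open between `U` and) `D(t)`, `t ∈ Γ(U, 𝒪_X)`, is killed by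
a power of `t`. [cite: Hartshorne1977, II Lemma 5.3 (a) (p. 112)] -/
theorem exists_pow_smul_eq_zero_of_noetherianSpace (hG : IsAffineLocalizing G) (U : X.Opens)
    (t : Γ(X, U)) (x : Γ(G, U)) {W : X.Opens} (hWU : W ≤ U) (htW : X.basicOpen t ≤ W)
    (hx : G.presheaf.map (homOfLE hWU).op x = 0) : ∃ n : ℕ, t ^ n • x = 0 := by
  classical
  obtain ⟨T, hT⟩ := exists_finset_affine_cover U (NoetherianSpace.isCompact _)
  let V : T → X.Opens := fun i => (((i : {V : X.affineOpens // (V : X.Opens) ≤ U}) : X.affineOpens) :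
    X.Opens)
  have hV : ∀ i, IsAffineOpen (V i) := fun i => i.1.1.2
  have hVU : ∀ i, V i ≤ U := fun i => i.1.2
  -- local exponents
  have hloc : ∀ i, ∃ n : ℕ, X.presheaf.map (homOfLE (hVU i)).op t ^ n •
      G.presheaf.map (homOfLE (hVU i)).op x = 0 := by
    intro i
    refine hG.torsion (hV i) (X.presheaf.map (homOfLE (hVU i)).op t)
      (G.presheaf.map (homOfLE (hVU i)).op x) (inf_le_right : W ⊓ V i ≤ V i) ?_ ?_
    · rw [Scheme.basicOpen_res]
      exact inf_le_inf_right _ htW |>.trans_eq' (inf_comm _ _)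
    · rw [map_map, show (homOfLE (hVU i)).op ≫ (homOfLE (inf_le_right : W ⊓ V i ≤ V i)).op =
        (homOfLE hWU).op ≫ (homOfLE (inf_le_left : W ⊓ V i ≤ W)).op from Subsingleton.elim _ _,
        ← map_map, hx, map_zero]
  choose n hn using hloc
  refine ⟨Finset.univ.sup n, ?_⟩
  apply TopCat.Sheaf.eq_of_locally_eq' ⟨G.presheaf, G.isSheaf⟩ V U
    (fun i => homOfLE (hVU i)) hT.ge
  intro i
  change G.presheaf.map (homOfLE (hVU i)).op (t ^ Finset.univ.sup n • x) =
    G.presheaf.map (homOfLE (hVU i)).op 0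
  obtain ⟨d, hd⟩ := Nat.exists_eq_add_of_le (Finset.le_sup (f := n) (Finset.mem_univ i))
  rw [map_zero, Scheme.Modules.map_smul, map_pow, hd, pow_add, mul_comm, mul_smul, hn, smul_zero]

/-- **Numerators over a quasi-compact open** (Hartshorne II Lemma 5.3 (b) for `U` quasi-compact with
quasi-compact intersections): every section of `G` over `D(t)`, `t ∈ Γ(U, 𝒪_X)`, multiplied by a
suitable power of `t`, extends to `U`. [cite: Hartshorne1977, II Lemma 5.3 (b) (p. 112)] -/
theorem exists_map_eq_pow_smul_of_noetherianSpace (hG : IsAffineLocalizing G) (U : X.Opens)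
    (t : Γ(X, U)) {W : X.Opens} (hW : W = X.basicOpen t) (s : Γ(G, W)) :
    ∃ (n : ℕ) (x : Γ(G, U)), G.presheaf.map (homOfLE (hW.trans_le (X.basicOpen_le t))).op x =
      X.presheaf.map (homOfLE (hW.trans_le (X.basicOpen_le t))).op t ^ n • s := by
  classical
  have hWU : W ≤ U := hW.trans_le (X.basicOpen_le t)
  obtain ⟨T, hT⟩ := exists_finset_affine_cover U (NoetherianSpace.isCompact _)
  let V : T → X.Opens := fun i => (((i : {V : X.affineOpens // (V : X.Opens) ≤ U}) : X.affineOpens) :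
    X.Opens)
  have hV : ∀ i, IsAffineOpen (V i) := fun i => i.1.1.2
  have hVU : ∀ i, V i ≤ U := fun i => i.1.2
  -- restrictions of `t`
  have tres : ∀ {W₁ W₂ : X.Opens} (h₁ : W₁ ≤ U) (h₂ : W₂ ≤ W₁),
      X.presheaf.map (homOfLE h₂).op (X.presheaf.map (homOfLE h₁).op t) =
        X.presheaf.map (homOfLE (h₂.trans h₁)).op t := fun h₁ h₂ => by
    rw [ringMap_map]; rfl
  have hWi : ∀ i, W ⊓ V i = X.basicOpen (X.presheaf.map (homOfLE (hVU i)).op t) := fun i => by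
    rw [Scheme.basicOpen_res, hW, inf_comm]
  -- local numerators, uniform exponent `N`
  have hnum := fun i => hG.numerator (hV i) (X.presheaf.map (homOfLE (hVU i)).op t) (hWi i)
    (G.presheaf.map (homOfLE inf_le_left).op s)
  choose n x hx using hnum
  let N : ℕ := Finset.univ.sup n
  have hNi : ∀ i, n i ≤ N := fun i => Finset.le_sup (f := n) (Finset.mem_univ i)
  set x' : ∀ i, Γ(G, V i) := fun i => X.presheaf.map (homOfLE (hVU i)).op t ^ (N - n i) • x i
    with x'def
  have hx' : ∀ i, G.presheaf.map (homOfLE (inf_le_right : W ⊓ V i ≤ V i)).op (x' i) =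
      X.presheaf.map (homOfLE ((inf_le_left : W ⊓ V i ≤ W).trans hWU)).op t ^ N •
        G.presheaf.map (homOfLE (inf_le_left : W ⊓ V i ≤ W)).op s := by
    intro i
    have e := hx i
    rw [tres] at e
    change G.presheaf.map (homOfLE inf_le_right).op (_ • x i) = _
    rw [Scheme.Modules.map_smul, map_pow, tres,
      show G.presheaf.map (homOfLE (inf_le_right : W ⊓ V i ≤ V i)).op (x i) = _ from
        (congrArg (fun φ => G.presheaf.map φ (x i)) (Subsingleton.elim _ _)).trans e,
      ← mul_smul, ← pow_add, Nat.sub_add_cancel (hNi i)]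
  clear_value x'
  -- the differences on `V i ⊓ V j` vanish on `W ⊓ V i ⊓ V j`, hence are killed by a power of `t`
  have hdiff : ∀ i j, ∃ m : ℕ,
      X.presheaf.map (homOfLE ((inf_le_left : V i ⊓ V j ≤ V i).trans (hVU i))).op t ^ m •
      (G.presheaf.map (homOfLE (inf_le_left : V i ⊓ V j ≤ V i)).op (x' i) -
        G.presheaf.map (homOfLE (inf_le_right : V i ⊓ V j ≤ V j)).op (x' j)) = 0 := by
    intro i j
    refine exists_pow_smul_eq_zero_of_noetherianSpace hG (V i ⊓ V j) _ _
      (inf_le_right : W ⊓ (V i ⊓ V j) ≤ V i ⊓ V j) ?_ ?_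
    · rw [Scheme.basicOpen_res, ← hW]
      exact le_of_eq (inf_comm _ _)
    · rw [map_sub, map_map, map_map,
        show (homOfLE (inf_le_left : V i ⊓ V j ≤ V i)).op ≫ (homOfLE (inf_le_right :
            W ⊓ (V i ⊓ V j) ≤ V i ⊓ V j)).op = (homOfLE (inf_le_right : W ⊓ V i ≤ V i)).op ≫
            (homOfLE (inf_le_inf_left W inf_le_left : W ⊓ (V i ⊓ V j) ≤ W ⊓ V i)).op from
          Subsingleton.elim _ _,
        show (homOfLE (inf_le_right : V i ⊓ V j ≤ V j)).op ≫ (homOfLE (inf_le_right :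
            W ⊓ (V i ⊓ V j) ≤ V i ⊓ V j)).op = (homOfLE (inf_le_right : W ⊓ V j ≤ V j)).op ≫
            (homOfLE (inf_le_inf_left W inf_le_right : W ⊓ (V i ⊓ V j) ≤ W ⊓ V j)).op from
          Subsingleton.elim _ _,
        ← map_map, ← map_map, hx', hx', Scheme.Modules.map_smul, Scheme.Modules.map_smul, map_pow,
        map_pow, tres, tres, map_map, map_map, sub_eq_zero]
      congr 1
  choose m hm using hdiff
  let M : ℕ := Finset.univ.sup fun p : T × T => m p.1 p.2
  have hMij : ∀ i j, m i j ≤ M := fun i j =>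
    Finset.le_sup (f := fun p : T × T => m p.1 p.2) (Finset.mem_univ (i, j))
  -- glue the `t^M • x' i`
  let y : ∀ i, Γ(G, V i) := fun i => X.presheaf.map (homOfLE (hVU i)).op t ^ M • x' i
  obtain ⟨z, hz, -⟩ := TopCat.Sheaf.existsUnique_gluing' ⟨G.presheaf, G.isSheaf⟩ V U
    (fun i => homOfLE (hVU i)) hT.ge y fun i j => by
      change G.presheaf.map (homOfLE inf_le_left).op (_ • x' i) =
        G.presheaf.map (homOfLE inf_le_right).op (_ • x' j)
      rw [Scheme.Modules.map_smul, Scheme.Modules.map_smul, map_pow, map_pow, tres, tres,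
        ← sub_eq_zero, ← smul_sub]
      obtain ⟨d, hd⟩ := Nat.exists_eq_add_of_le (hMij i j)
      rw [hd, pow_add, mul_comm, mul_smul, hm, smul_zero]
  refine ⟨N + M, z, ?_⟩
  -- check on the cover `W ⊓ V i` of `W`
  apply TopCat.Sheaf.eq_of_locally_eq' ⟨G.presheaf, G.isSheaf⟩ (fun i => W ⊓ V i) W
    (fun i => homOfLE inf_le_left)
  · intro w hw
    have hw' : w ∈ (⨆ i, V i : X.Opens) := by rw [hT]; exact hWU hw
    obtain ⟨i, hi⟩ := Opens.mem_iSup.mp hw'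
    exact Opens.mem_iSup.mpr ⟨i, hw, hi⟩
  intro i
  change G.presheaf.map (homOfLE inf_le_left).op (G.presheaf.map (homOfLE hWU).op z) =
    G.presheaf.map (homOfLE inf_le_left).op (_ • s)
  rw [map_map, show (homOfLE hWU).op ≫ (homOfLE (inf_le_left : W ⊓ V i ≤ W)).op =
      (homOfLE (hVU i)).op ≫ (homOfLE (inf_le_right : W ⊓ V i ≤ V i)).op from Subsingleton.elim _ _,
    ← map_map]
  change G.presheaf.map _ ((G.presheaf.map (homOfLE (hVU i)).op) z) = _
  rw [hz i]
  change G.presheaf.map (homOfLE inf_le_right).op (_ • x' i) = _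
  rw [Scheme.Modules.map_smul, map_pow, tres, hx', Scheme.Modules.map_smul, map_pow, tres,
    ← mul_smul, ← pow_add, add_comm]

end Qcqs

/-! ### Direct images -/

section Pushforward

variable {X' X : Scheme.{u}} (π : X' ⟶ X) {G : X'.Modules}

/-- **`π_* G` is affine-localizing** for `G` affine-localizing on a Noetherian `X'` and any
`π : X' → X` (`π⁻¹D(r) = D(π^* r)` inside the quasi-compact `π⁻¹V`).
[cite: Hartshorne1977, II Prop. 5.8 (c) (p. 115)] -/
theorem isAffineLocalizing_pushforward [NoetherianSpace X'] (hG : IsAffineLocalizing G) :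
    IsAffineLocalizing ((Scheme.Modules.pushforward π).obj G) := by
  constructor
  · intro V hV r W hW s
    have hι : W ≤ V := hW.trans_le (X.basicOpen_le r)
    have eW : π ⁻¹ᵁ W = X'.basicOpen (π.app V r) := by rw [hW, Scheme.preimage_basicOpen]
    obtain ⟨n, x, hx⟩ := exists_map_eq_pow_smul_of_noetherianSpace hG (π ⁻¹ᵁ V) (π.app V r) eW s
    refine ⟨n, x, ?_⟩
    change G.presheaf.map ((Opens.map π.base).map (homOfLE hι)).op x =
      π.app W (X.presheaf.map (homOfLE hι).op r ^ n) • (show Γ(G, π ⁻¹ᵁ W) from s)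
    rw [map_pow, show π.app W (X.presheaf.map (homOfLE hι).op r) =
        X'.presheaf.map ((Opens.map π.base).map (homOfLE hι)).op (π.app V r) from
      ConcreteCategory.congr_hom (π.naturality (homOfLE hι).op) r]
    refine (congrArg (fun φ => G.presheaf.map φ x) (Subsingleton.elim _ _)).trans (hx.trans ?_)
    exact congrArg (fun φ => X'.presheaf.map φ (π.app V r) ^ n • (show Γ(G, π ⁻¹ᵁ W) from s))
      (Subsingleton.elim _ _)
  · intro V hV r x W hWV hrW hx
    have hD : X'.basicOpen (π.app V r) ≤ π ⁻¹ᵁ W := by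
      rw [← Scheme.preimage_basicOpen]; exact π.preimage_mono hrW
    obtain ⟨n, hn⟩ := exists_pow_smul_eq_zero_of_noetherianSpace hG (π ⁻¹ᵁ V) (π.app V r)
      (show Γ(G, π ⁻¹ᵁ V) from x) (π.preimage_mono hWV) hD
      ((congrArg (fun φ => G.presheaf.map φ (show Γ(G, π ⁻¹ᵁ V) from x))
        (Subsingleton.elim _ _)).trans hx)
    refine ⟨n, ?_⟩
    rw [pushforward_smul, map_pow]
    exact hn

/-- `Γ(V, 𝒪_X) = Γ(V(⊤), 𝒪_V) → Γ((π⁻¹V)(⊤), 𝒪_{π⁻¹V}) = Γ(π⁻¹V, 𝒪_{X'})` is `π^*` over `V`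
(Mathlib `Scheme.Hom.resLE_app_top`). [folklore] -/
theorem topIso_inv_appTop_topIso_hom (V : X.Opens) :
    V.topIso.inv ≫ (π ∣_ V).appTop ≫ (π ⁻¹ᵁ V).topIso.hom = π.app V := by
  rw [← Scheme.Hom.resLE_eq_morphismRestrict, Scheme.Hom.appTop, Scheme.Hom.resLE_app_top]
  simp only [Category.assoc, Iso.inv_hom_id, Category.comp_id, Iso.inv_hom_id_assoc,
    Scheme.Hom.appLE_eq_app]

/-- `Γ(⊤, 𝒪_{π⁻¹V}) = Γ(π⁻¹V, 𝒪_{X'})` on elements. [folklore] -/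
theorem ι_appIso_inv_apply (U : X'.Opens) (z : Γ((↑U : Scheme.{u}), ⊤)) :
    (U.ι.appIso ⊤).inv z = z := by
  rw [Scheme.Opens.ι_appIso]
  rfl

/-- The structure map `Γ(V, 𝒪_X) → Γ((π⁻¹V)(⊤), 𝒪) = Γ(π⁻¹V, 𝒪_{X'})` of the proper `V`-scheme
`π⁻¹V → V ≅ Spec Γ(V, 𝒪_X)` is `π^*`. [folklore] -/
theorem topIso_hom_algebraMapΓ {V : X.Opens} (hV : IsAffineOpen V) (a : Γ(X, V)) :
    haveI : IsAffine V := hV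
    (π ⁻¹ᵁ V).topIso.hom
      (algebraMapΓ ((π ∣_ V) ≫ hV.isoSpec.hom : (↑(π ⁻¹ᵁ V) : Scheme.{u}) ⟶ Spec (.of Γ(X, V))) a) =
      π.app V a := by
  haveI : IsAffine V := hV
  have h := ConcreteCategory.congr_hom (topIso_inv_appTop_topIso_hom π V) a
  simp only [CommRingCat.comp_apply] at h
  change (π ⁻¹ᵁ V).topIso.hom
    (((π ∣_ V) ≫ hV.isoSpec.hom).appTop ((Scheme.ΓSpecIso Γ(X, V)).inv a)) = _
  rw [Scheme.Hom.comp_appTop, IsAffineOpen.isoSpec_hom_appTop]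
  simp only [CommRingCat.comp_apply, Iso.inv_hom_id_apply]
  exact h

variable [IsProper π] [IsLocallyNoetherian X]

/-- **`Γ(π⁻¹V, G)` is a finite `Γ(V, 𝒪_X)`-module** for `π : X' → X` proper, `X` locally
Noetherian, `G` coherent and `V ⊆ X` affine open (the finiteness theorem, GW II Thm. 23.17 for
`i = 0`, over the Noetherian ring `Γ(V, 𝒪_X)`, applied to `π⁻¹V → V` and `G|_{π⁻¹V}`).
[cite: GortzWedhorn2023, Thm. 23.17 (p. 424)] -/
theorem moduleFinite_app_pushforward_of_isProper (hG : Coh G) {V : X.Opens} (hV : IsAffineOpen V) :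
    Module.Finite Γ(X, V) Γ((Scheme.Modules.pushforward π).obj G, V) := by
  haveI : IsAffine V := hV
  haveI : IsNoetherianRing Γ(X, V) := IsLocallyNoetherian.component_noetherian ⟨V, hV⟩
  haveI : IsLocallyNoetherian X' := LocallyOfFiniteType.isLocallyNoetherian π
  let U : X'.Opens := π ⁻¹ᵁ V
  let f' : (↑U : Scheme.{u}) ⟶ Spec (.of Γ(X, V)) := (π ∣_ V) ≫ hV.isoSpec.hom
  haveI : IsProper (π ∣_ V) := MorphismProperty.of_isPullback (isPullback_morphismRestrict π V).flip ‹_›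
  haveI : IsProper f' := inferInstance
  have hfin : Module.Finite Γ(X, V) (MSections f' (G.restrict U.ι) ⊤) :=
    moduleFinite_msections_of_coh f' (coh_restrict U.ι G hG)
  -- the comparison `Γ((π⁻¹V)(⊤), G) → Γ(π⁻¹V, G)`, linear over `Γ(V, 𝒪_X)`
  have hj : X'.presheaf.map (eqToHom U.ι_image_top.symm).op = U.topIso.hom := by
    rw [Scheme.Opens.topIso_hom]
  let e : MSections f' (G.restrict U.ι) ⊤ →ₗ[Γ(X, V)] Γ((Scheme.Modules.pushforward π).obj G, V) :=
    { toFun := fun m => G.presheaf.map (eqToHom U.ι_image_top.symm).op (show Γ(G, U.ι ''ᵁ ⊤) from m)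
      map_add' := fun m m' => map_add _ _ _
      map_smul' := fun a m => by
        change G.presheaf.map (eqToHom U.ι_image_top.symm).op
            (((U.ι.appIso ⊤).inv ((↑U : Scheme.{u}).presheaf.map
              (homOfLE (le_top : (⊤ : (↑U : Scheme.{u}).Opens) ≤ ⊤)).op (algebraMapΓ f' a)) :
                Γ(X', U.ι ''ᵁ ⊤)) • (show Γ(G, U.ι ''ᵁ ⊤) from m)) =
          (π.app V a • G.presheaf.map (eqToHom U.ι_image_top.symm).op (show Γ(G, U.ι ''ᵁ ⊤) from m) :
            Γ(G, π ⁻¹ᵁ V))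
        rw [Scheme.Modules.map_smul, ringMap_self, ι_appIso_inv_apply]
        congr 1
        rw [← topIso_hom_algebraMapΓ π hV a, ← hj]
        rfl }
  refine Module.Finite.of_surjective e fun s => ⟨G.presheaf.map (eqToHom U.ι_image_top).op s, ?_⟩
  exact (map_map G _ _ s).trans (map_self G _ s)

/-- **`π_* G` is of affine-finite type** for `π` proper, `X` locally Noetherian and `G` coherent.
[cite: GortzWedhorn2023, Thm. 23.17 (p. 424)] -/
theorem isAffineFiniteType_pushforward_of_isProper (hG : Coh G) :
    IsAffineFiniteType ((Scheme.Modules.pushforward π).obj G) :=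
  fun _ hV => moduleFinite_app_pushforward_of_isProper π hG hV

/-- **Direct images of coherent modules under proper morphisms are coherent** (EGA III 3.2.1 in
degree `0`; `X'` Noetherian, `X` locally Noetherian).
[cite: StacksProject, Tag 02O5 (Cohomology of Schemes, Proposition 30.19.1, i = 0)] -/
theorem coh_pushforward_of_isProper [CompactSpace X'] (hG : Coh G) :
    Coh ((Scheme.Modules.pushforward π).obj G) :=
  haveI : IsLocallyNoetherian X' := LocallyOfFiniteType.isLocallyNoetherian π
  haveI : IsNoetherian X' := ⟨⟩
  ⟨isAffineLocalizing_pushforward π hG.loc, isAffineFiniteType_pushforward_of_isProper π hG⟩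

end Pushforward

end Literature.AlgebraicGeometry.Morphisms

end
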